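import Mathlib.MeasureTheory.Constructions.HaarToSphere
import Mathlib.Analysis.SpecialFunctions.JapaneseBracket
import Mathlib.Analysis.SpecialFunctions.Integrals.Basic
import Mathlib.Analysis.SpecialFunctions.Pow.Deriv
import Mathlib.MeasureTheory.Measure.Haar.NormedSpace
import Mathlib.MeasureTheory.Measure.Haar.Unique
import Mathlib.MeasureTheory.Group.Integral
import Literature.Analysis.FluidPDE.RadialCalculus
import HarnessLib

/-!
# The Newtonian kernel of a finite-dimensional real inner product space (`n ≥ 3`), I:
# kernels, regularisation, the approximate identity, local integrability

Analysis/PDE support file (definitions with bodies and PROVED theorems only; no named facts) on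
the discharge path of `Literature.Analysis.PDE.LoewnerNirenberg.exists_isMaximalSolution`
(Loewner–Nirenberg 1974: the maximal solution of `Δu = ¼n(n-2)u^{(n+2)/(n-2)}` on an arbitrary
domain), proved by Perron's method from a local solver on small balls built out of the Poisson
operator of the ball and the Newtonian potential (`NewtonianPotential.lean`).

Everything is coordinate-free on a real inner product space `E`, `n = finrank ℝ E` (used for
`n ≥ 3`), with Mathlib's Laplacian `Δ` and the Haar measure `volume`:

* `Newtonian.expo E = (n-2)/2`; `Newtonian.regKernel a ξ = (‖ξ‖² + a)^{-(n-2)/2}` (`a ≥ 0`;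
  `a = 0` is `‖ξ‖^{2-n}`); `Newtonian.regBump a ξ = n(n-2) a (‖ξ‖² + a)^{-(n+2)/2}`, and
  **`Δ (regKernel a) = -regBump a`** wherever `‖ξ‖² + a > 0` (`laplacian_regKernel`, from the
  radial formula `Δ g(‖ξ‖²) = 4‖ξ‖² g'' + 2n g'` of `FluidPDE/RadialCalculus`); in particular
  `‖ξ‖^{2-n}` is harmonic off the origin.
* `Newtonian.bumpMass E = ∫ regBump 1 > 0` (`bumpMass_pos`), the normalised kernels
  `Newtonian.kernel a = -(bumpMass E)⁻¹ · regKernel a` — `kernel 0 = Γ` is THE NEWTONIAN KERNEL,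
  normalised so that `Δ(Γ * g) = g` (Gilbarg–Trudinger (2.12), the constant written as an
  integral, its value `((n-2)|S^{n-1}|)⁻¹` never being needed) — and the approximate identity
  `Newtonian.approxId a = (bumpMass E)⁻¹ · regBump a = Δ (kernel a)` (`laplacian_kernel`):
  nonnegative, of total mass `1` for `a = ε²` (`integral_approxId_sq`, by the scaling
  `regBump (ε²) ξ = ε^{-n} regBump 1 (ε⁻¹ξ)`), with small mass off any ball as `ε → 0`
  (`tendsto_integral_approxId_indicator_compl_ball`), whence **`ρ_{ε²} * g (x) → g(x)`** for
  bounded uniformly continuous `g` (`tendsto_integral_approxId_mul`).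
* local integrability: **`∫_{B(0,r)} ‖ξ‖^{-s} dξ = n |B₁| r^{n-s} / (n-s)`** for `s < n`
  (`integral_ball_norm_rpow_neg`, Mathlib's polar formula `integral_fun_norm_addHaar`), the
  derivative of the kernels `D(kernel a)(ξ) = (2k/A)(‖ξ‖² + a)^{-k-1} ⟪ξ, ·⟫` with the uniform
  bound `‖D(kernel a)(ξ)‖ ≤ (2k/A) ‖ξ‖^{1-n}` and the domination `|kernel a| ≤ |kernel 0|`.

## References

* D. Gilbarg, N. S. Trudinger, *Elliptic Partial Differential Equations of Second Order*
  (Springer 2001), §2.4 (2.12), §4.1. [GilbargTrudinger2001]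
-/

noncomputable section

open MeasureTheory Metric Set Filter Function Module InnerProductSpace
open scoped Laplacian RealInnerProductSpace Topology

namespace Literature.Analysis.PDE

namespace Newtonian

section Basic

variable {E : Type*} [NormedAddCommGroup E] [InnerProductSpace ℝ E]

/-! ### The exponent `k = (n-2)/2` -/

variable (E) in
/-- The exponent `k = (n-2)/2` of the Newtonian kernel `‖ξ‖^{2-n} = (‖ξ‖²)^{-k}`, `n = dim E`.
[folklore] -/
def expo : ℝ := ((finrank ℝ E : ℝ) - 2) / 2

/-- `2k = n - 2`. [folklore] -/
theorem two_mul_expo : 2 * expo E = (finrank ℝ E : ℝ) - 2 := by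
  unfold expo; ring

/-- `k > 0` for `n ≥ 3`. [folklore] -/
theorem expo_pos (hn : 3 ≤ finrank ℝ E) : 0 < expo E := by
  unfold expo
  have : (3 : ℝ) ≤ finrank ℝ E := by exact_mod_cast hn
  linarith

/-- `(3 : ℝ) ≤ n`. [folklore] -/
theorem three_le_cast (hn : 3 ≤ finrank ℝ E) : (3 : ℝ) ≤ finrank ℝ E := by exact_mod_cast hn

/-! ### The regularised kernels and bumps -/

/-- The regularised radial kernel `(‖ξ‖² + a)^{-(n-2)/2}`; for `a = 0` the Newtonian profile
`‖ξ‖^{2-n}` (up to sign and normalisation). [folklore] -/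
def regKernel (a : ℝ) (ξ : E) : ℝ := (‖ξ‖ ^ 2 + a) ^ (-expo E)

/-- The bump `n(n-2) a (‖ξ‖² + a)^{-(n+2)/2}`, which is `-Δ` of `regKernel a`. [folklore] -/
def regBump (a : ℝ) (ξ : E) : ℝ :=
  (finrank ℝ E : ℝ) * ((finrank ℝ E : ℝ) - 2) * a * (‖ξ‖ ^ 2 + a) ^ (-expo E - 2)

omit [InnerProductSpace ℝ E] in
/-- The base `‖ξ‖² + a` is positive when `a > 0`. [folklore] -/
theorem base_pos_of_pos {a : ℝ} (ha : 0 < a) (ξ : E) : 0 < ‖ξ‖ ^ 2 + a := by positivity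

omit [InnerProductSpace ℝ E] in
/-- The base `‖ξ‖² + a` is positive when `a ≥ 0` and `ξ ≠ 0`. [folklore] -/
theorem base_pos_of_ne {a : ℝ} (ha : 0 ≤ a) {ξ : E} (hξ : ξ ≠ 0) : 0 < ‖ξ‖ ^ 2 + a := by
  have : 0 < ‖ξ‖ := norm_pos_iff.2 hξ
  positivity

/-- `regKernel a ξ > 0` whenever the base is positive. [folklore] -/
theorem regKernel_pos {a : ℝ} {ξ : E} (h : 0 < ‖ξ‖ ^ 2 + a) : 0 < regKernel a ξ :=
  Real.rpow_pos_of_pos h _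

/-- `regKernel a ξ ≥ 0`. [folklore] -/
theorem regKernel_nonneg {a : ℝ} (ha : 0 ≤ a) (ξ : E) : 0 ≤ regKernel a ξ :=
  Real.rpow_nonneg (by positivity) _

/-- Domination `regKernel a ξ ≤ regKernel 0 ξ` for `a ≥ 0`, `ξ ≠ 0`, `n ≥ 2` (the exponent is
nonpositive and the base increases with `a`). [folklore] -/
theorem regKernel_le_regKernel_zero (hn : 2 ≤ finrank ℝ E) {a : ℝ} (ha : 0 ≤ a) {ξ : E}
    (hξ : ξ ≠ 0) : regKernel a ξ ≤ regKernel 0 ξ := by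
  unfold regKernel
  have hk : -expo E ≤ 0 := by
    unfold expo
    have : (2 : ℝ) ≤ finrank ℝ E := by exact_mod_cast hn
    have : 0 ≤ ((finrank ℝ E : ℝ) - 2) / 2 := by linarith
    linarith
  rw [add_zero]
  exact Real.rpow_le_rpow_of_nonpos (by positivity) (by linarith) hk

/-- `regBump a ξ ≥ 0` for `a ≥ 0`, `n ≥ 3`. [folklore] -/
theorem regBump_nonneg (hn : 3 ≤ finrank ℝ E) {a : ℝ} (ha : 0 ≤ a) (ξ : E) : 0 ≤ regBump a ξ := by
  unfold regBump
  have h3 := three_le_cast hn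
  have h1 : (0 : ℝ) ≤ (finrank ℝ E : ℝ) * ((finrank ℝ E : ℝ) - 2) :=
    mul_nonneg (by linarith) (by linarith)
  exact mul_nonneg (mul_nonneg h1 ha) (Real.rpow_nonneg (by positivity) _)

/-- `regBump a ξ > 0` for `a > 0`, `n ≥ 3`. [folklore] -/
theorem regBump_pos (hn : 3 ≤ finrank ℝ E) {a : ℝ} (ha : 0 < a) (ξ : E) : 0 < regBump a ξ := by
  unfold regBump
  have h3 := three_le_cast hn
  have h1 : (0 : ℝ) < (finrank ℝ E : ℝ) * ((finrank ℝ E : ℝ) - 2) :=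
    mul_pos (by linarith) (by linarith)
  exact mul_pos (mul_pos h1 ha) (Real.rpow_pos_of_pos (base_pos_of_pos ha ξ) _)

/-- `regBump 0 = 0`. [folklore] -/
@[simp] theorem regBump_zero (ξ : E) : regBump 0 ξ = 0 := by simp [regBump]

/-! ### Smoothness of the regularised kernels -/

/-- For `a > 0` the regularised kernel is smooth on `E`. [folklore] -/
theorem contDiff_regKernel {a : ℝ} (ha : 0 < a) {m : WithTop ℕ∞} :
    ContDiff ℝ m (regKernel a : E → ℝ) :=
  ((contDiff_norm_sq ℝ).add contDiff_const).rpow_const_of_ne fun ξ => (base_pos_of_pos ha ξ).ne'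

/-- For `a > 0` the bump `regBump a` is smooth on `E`. [folklore] -/
theorem contDiff_regBump {a : ℝ} (ha : 0 < a) {m : WithTop ℕ∞} :
    ContDiff ℝ m (regBump a : E → ℝ) :=
  contDiff_const.mul
    (((contDiff_norm_sq ℝ).add contDiff_const).rpow_const_of_ne fun ξ => (base_pos_of_pos ha ξ).ne')

/-- The regularised kernel `regKernel a` (`a ≥ 0`) is smooth off the origin. [folklore] -/
theorem contDiffAt_regKernel {a : ℝ} (ha : 0 ≤ a) {ξ : E} (hξ : ξ ≠ 0) {m : WithTop ℕ∞} :
    ContDiffAt ℝ m (regKernel a : E → ℝ) ξ := by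
  have h1 : ContDiffAt ℝ m (fun w : E => ‖w‖ ^ 2 + a) ξ :=
    ((contDiff_norm_sq ℝ).add contDiff_const).contDiffAt
  exact h1.rpow_const_of_ne (base_pos_of_ne ha hξ).ne'

/-- The kernels are continuous off the origin (all `a ≥ 0`). [folklore] -/
theorem continuousAt_regKernel {a : ℝ} (ha : 0 ≤ a) {ξ : E} (hξ : ξ ≠ 0) :
    ContinuousAt (regKernel a : E → ℝ) ξ :=
  (contDiffAt_regKernel ha hξ (m := 0)).continuousAt

/-! ### Derivatives of the regularised kernels -/

/-- `d/dσ (σ + a)^{-p} = -p (σ + a)^{-p-1}` on `σ + a > 0`. [folklore] -/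
theorem hasDerivAt_add_rpow (a p : ℝ) {σ : ℝ} (hσ : 0 < σ + a) :
    HasDerivAt (fun τ : ℝ => (τ + a) ^ (-p)) (-p * (σ + a) ^ (-p - 1)) σ := by
  have h : HasDerivAt (fun τ : ℝ => τ + a) 1 σ := (hasDerivAt_id σ).add_const a
  have := h.rpow_const (p := -p) (Or.inl hσ.ne')
  simpa [mul_comm] using this

/-- **The derivative of the regularised kernel**:
`D(regKernel a)(ξ) = -2k (‖ξ‖² + a)^{-k-1} ⟪ξ, ·⟫` wherever `‖ξ‖² + a > 0`. [folklore] -/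
theorem hasFDerivAt_regKernel {a : ℝ} {ξ : E} (hξ : 0 < ‖ξ‖ ^ 2 + a) :
    HasFDerivAt (regKernel a : E → ℝ)
      ((2 * (-expo E * (‖ξ‖ ^ 2 + a) ^ (-expo E - 1))) • (innerSL ℝ ξ : E →L[ℝ] ℝ)) ξ :=
  Literature.Analysis.FluidPDE.hasFDerivAt_comp_norm_sq (hasDerivAt_add_rpow a (expo E) hξ)

/-- The norm bound `‖D(regKernel a)(ξ)‖ ≤ 2k (‖ξ‖² + a)^{-k-1} ‖ξ‖` (`k ≥ 0`). [folklore] -/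
theorem norm_fderiv_regKernel_le (hn : 2 ≤ finrank ℝ E) {a : ℝ} {ξ : E} (hξ : 0 < ‖ξ‖ ^ 2 + a) :
    ‖fderiv ℝ (regKernel a : E → ℝ) ξ‖ ≤ 2 * expo E * (‖ξ‖ ^ 2 + a) ^ (-expo E - 1) * ‖ξ‖ := by
  rw [(hasFDerivAt_regKernel hξ).fderiv, norm_smul]
  have hk : 0 ≤ expo E := by
    unfold expo
    have : (2 : ℝ) ≤ finrank ℝ E := by exact_mod_cast hn
    linarith
  have hp : 0 ≤ (‖ξ‖ ^ 2 + a) ^ (-expo E - 1) := Real.rpow_nonneg hξ.le _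
  have h1 : ‖(2 * (-expo E * (‖ξ‖ ^ 2 + a) ^ (-expo E - 1)))‖ =
      2 * expo E * (‖ξ‖ ^ 2 + a) ^ (-expo E - 1) := by
    rw [Real.norm_eq_abs, show 2 * (-expo E * (‖ξ‖ ^ 2 + a) ^ (-expo E - 1)) =
      -(2 * expo E * (‖ξ‖ ^ 2 + a) ^ (-expo E - 1)) by ring, abs_neg, abs_of_nonneg]
    positivity
  rw [h1]
  exact mul_le_mul_of_nonneg_left (innerSL_apply_norm ℝ ξ).le (by positivity)

/-- `(‖ξ‖² + a)^{-k-1} ‖ξ‖ ≤ ‖ξ‖^{1-n}`... precisely `≤ ‖ξ‖ ^ (-(2k+1))`, for `ξ ≠ 0`, `a ≥ 0`.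
[folklore] -/
theorem base_rpow_mul_norm_le (hn : 2 ≤ finrank ℝ E) {a : ℝ} (ha : 0 ≤ a) {ξ : E} (hξ : ξ ≠ 0) :
    (‖ξ‖ ^ 2 + a) ^ (-expo E - 1) * ‖ξ‖ ≤ ‖ξ‖ ^ (-(2 * expo E + 1)) := by
  have hn0 : 0 < ‖ξ‖ := norm_pos_iff.2 hξ
  have hk : 0 ≤ expo E := by
    unfold expo
    have : (2 : ℝ) ≤ finrank ℝ E := by exact_mod_cast hn
    linarith
  have h1 : (‖ξ‖ ^ 2 + a) ^ (-expo E - 1) ≤ (‖ξ‖ ^ 2) ^ (-expo E - 1) :=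
    Real.rpow_le_rpow_of_nonpos (by positivity) (by linarith) (by linarith)
  have h2 : (‖ξ‖ ^ 2) ^ (-expo E - 1) * ‖ξ‖ = ‖ξ‖ ^ (-(2 * expo E + 1)) := by
    rw [show (‖ξ‖ ^ 2 : ℝ) = ‖ξ‖ ^ (2 : ℝ) by norm_cast, ← Real.rpow_mul hn0.le,
      show ‖ξ‖ ^ (-(2 * expo E + 1)) = ‖ξ‖ ^ ((2 : ℝ) * (-expo E - 1) + 1) by congr 1; ring,
      Real.rpow_add hn0, Real.rpow_one]
  calc (‖ξ‖ ^ 2 + a) ^ (-expo E - 1) * ‖ξ‖ ≤ (‖ξ‖ ^ 2) ^ (-expo E - 1) * ‖ξ‖ :=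
        mul_le_mul_of_nonneg_right h1 hn0.le
    _ = ‖ξ‖ ^ (-(2 * expo E + 1)) := h2

/-! ### Scaling of the bumps: `regBump (ε²) ξ = ε^{-n} regBump 1 (ε⁻¹ ξ)` -/

/-- `(ε²)^{-(n+2)/2} = (ε^{n+2})⁻¹` for `ε > 0`. [folklore] -/
theorem sq_rpow_neg_expo_sub_two {ε : ℝ} (hε : 0 < ε) :
    (ε ^ 2) ^ (-expo E - 2) = (ε ^ (finrank ℝ E + 2))⁻¹ := by
  have h1 : (-expo E - 2) = -(((finrank ℝ E + 2 : ℕ) : ℝ) / 2) := by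
    unfold expo; push_cast; ring
  have h2 : (ε ^ 2 : ℝ) = ε ^ (2 : ℝ) := by norm_cast
  calc (ε ^ 2) ^ (-expo E - 2) = (ε ^ (2 : ℝ)) ^ (-(((finrank ℝ E + 2 : ℕ) : ℝ) / 2)) := by
        rw [h2, h1]
    _ = ε ^ ((2 : ℝ) * -(((finrank ℝ E + 2 : ℕ) : ℝ) / 2)) := (Real.rpow_mul hε.le _ _).symm
    _ = ε ^ (-((finrank ℝ E + 2 : ℕ) : ℝ)) := by congr 1; ring
    _ = (ε ^ ((finrank ℝ E + 2 : ℕ) : ℝ))⁻¹ := Real.rpow_neg hε.le _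
    _ = (ε ^ (finrank ℝ E + 2))⁻¹ := by rw [Real.rpow_natCast]

/-- **Scaling of the bumps.** [folklore] -/
theorem regBump_sq {ε : ℝ} (hε : 0 < ε) (ξ : E) :
    regBump (ε ^ 2) ξ = (ε ^ finrank ℝ E)⁻¹ * regBump 1 (ε⁻¹ • ξ) := by
  simp only [regBump]
  have hb : ‖ξ‖ ^ 2 + ε ^ 2 = ε ^ 2 * (‖ε⁻¹ • ξ‖ ^ 2 + 1) := by
    rw [norm_smul, norm_inv, Real.norm_eq_abs, abs_of_pos hε]
    field_simp
  rw [hb, Real.mul_rpow (by positivity) (by positivity), sq_rpow_neg_expo_sub_two hε]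
  have hε0 : ε ≠ 0 := hε.ne'
  field_simp
  ring

end Basic

/-! ### The Laplacian of the regularised kernel -/

section Laplacian

variable {E : Type*} [NormedAddCommGroup E] [InnerProductSpace ℝ E] [FiniteDimensional ℝ E]

omit [FiniteDimensional ℝ E] in
/-- `D(c • f) = c • Df` as functions (no differentiability needed: Mathlib's
`fderiv_const_smul_field`). [folklore] -/
theorem fderiv_const_smul_fun {F : Type*} [NormedAddCommGroup F] [NormedSpace ℝ F] (c : ℝ)
    (f : E → F) : fderiv ℝ (fun w => c • f w) = fun z => c • fderiv ℝ f z := by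
  have h : (fun w => c • f w) = c • f := rfl
  rw [h, fderiv_const_smul_field]
  rfl

/-- `Δ (c · f) = c · Δ f`, computed with Mathlib's total derivatives (no differentiability
needed). [folklore] -/
theorem laplacian_const_mul (c : ℝ) (f : E → ℝ) (x : E) :
    (Δ (fun w => c * f w)) x = c * (Δ f) x := by
  have e : (fun w => c * f w) = fun w => c • f w := rfl
  rw [e, InnerProductSpace.laplacian_eq_iteratedFDeriv_stdOrthonormalBasis,
    InnerProductSpace.laplacian_eq_iteratedFDeriv_stdOrthonormalBasis]
  simp only [iteratedFDeriv_two_apply, Finset.mul_sum]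
  refine Finset.sum_congr rfl fun i _ => ?_
  have h2 : fderiv ℝ (fderiv ℝ (fun w => c • f w)) = fun z => c • fderiv ℝ (fderiv ℝ f) z := by
    rw [fderiv_const_smul_fun c f]
    exact fderiv_const_smul_fun c (fderiv ℝ f)
  rw [h2]
  simp [smul_eq_mul]

/-- **`Δ (‖ξ‖² + a)^{-k} = -n(n-2) a (‖ξ‖² + a)^{-k-2}`** at every `ξ` with `‖ξ‖² + a > 0`
(`k = (n-2)/2`; the radial formula `Δ g(‖ξ‖²) = 4‖ξ‖² g'' + 2n g'` of `RadialCalculus`). For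
`a = 0` this is the harmonicity of `‖ξ‖^{2-n}` off the origin. [folklore] -/
theorem laplacian_regKernel {a : ℝ} {ξ : E} (hξ : 0 < ‖ξ‖ ^ 2 + a) :
    (Δ (regKernel a : E → ℝ)) ξ = -regBump a ξ := by
  set p : ℝ := expo E with hp
  set U : Set ℝ := Ioi (-a) with hU
  have hUo : IsOpen U := isOpen_Ioi
  have hmem : ‖ξ‖ ^ 2 ∈ U := by
    show -a < ‖ξ‖ ^ 2
    linarith
  have hg : ∀ σ ∈ U, HasDerivAt (fun τ : ℝ => (τ + a) ^ (-p)) (-p * (σ + a) ^ (-p - 1)) σ := by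
    intro σ hσ
    have hσ' : 0 < σ + a := by
      have : -a < σ := hσ
      linarith
    exact hasDerivAt_add_rpow a p hσ'
  have hg₁ : HasDerivAt (fun σ : ℝ => -p * (σ + a) ^ (-p - 1))
      (-p * (-(p + 1) * (‖ξ‖ ^ 2 + a) ^ (-(p + 1) - 1))) (‖ξ‖ ^ 2) := by
    have h := hasDerivAt_add_rpow a (p + 1) hξ
    have h' : HasDerivAt (fun τ : ℝ => (τ + a) ^ (-p - 1))
        (-(p + 1) * (‖ξ‖ ^ 2 + a) ^ (-(p + 1) - 1)) (‖ξ‖ ^ 2) := by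
      have e : (fun τ : ℝ => (τ + a) ^ (-p - 1)) = fun τ : ℝ => (τ + a) ^ (-(p + 1)) := by
        funext τ; congr 1; ring
      rw [e]; exact h
    exact h'.const_mul (-p)
  have key := Literature.Analysis.FluidPDE.laplacian_comp_norm_sq (E := E) hUo hg hmem hg₁
  have e1 : (fun w : E => (‖w‖ ^ 2 + a) ^ (-p)) = (regKernel a : E → ℝ) := by
    funext w; simp [regKernel, hp]
  rw [e1] at key
  rw [key]
  -- algebra: `(s+a)^{-p-1} = (s+a)^{-p-2} (s+a)` and `4p(p+1) = 2np = n(n-2)` as `n = 2p+2`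
  set s : ℝ := ‖ξ‖ ^ 2 with hs
  have hsa : s + a ≠ 0 := hξ.ne'
  have e2 : (s + a) ^ (-p - 1) = (s + a) ^ (-p - 2) * (s + a) := by
    rw [show (-p - 1 : ℝ) = (-p - 2) + 1 by ring, Real.rpow_add_one hsa]
  have e3 : (s + a) ^ (-(p + 1) - 1) = (s + a) ^ (-p - 2) := by
    congr 1; ring
  rw [e2, e3]
  simp only [regBump, ← hp]
  have hn2 : (finrank ℝ E : ℝ) = 2 * p + 2 := by rw [hp, expo]; ring
  rw [hn2]
  ring

/-- **`‖ξ‖^{2-n}` is harmonic off the origin**: `Δ (regKernel 0) ξ = 0` for `ξ ≠ 0`.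
[folklore] -/
theorem laplacian_regKernel_zero {ξ : E} (hξ : ξ ≠ 0) : (Δ (regKernel 0 : E → ℝ)) ξ = 0 := by
  rw [laplacian_regKernel (base_pos_of_ne le_rfl hξ)]
  simp

end Laplacian

/-! ### The mass, the normalised kernels and the approximate identity -/

section Measure

variable {E : Type*} [NormedAddCommGroup E] [InnerProductSpace ℝ E] [FiniteDimensional ℝ E]
  [MeasurableSpace E] [BorelSpace E]

variable (E) in
/-- The mass `A = ∫ n(n-2)(‖ξ‖² + 1)^{-(n+2)/2} dξ` of the unit bump (positive and finite for
`n ≥ 3`; it equals `(n-2)·|S^{n-1}|`, a value never needed). [folklore] -/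
def bumpMass : ℝ := ∫ ξ : E, regBump 1 ξ

/-- The normalised kernels `Γ_a(ξ) = -A⁻¹ (‖ξ‖² + a)^{-(n-2)/2}`; `Γ_0 = Γ` is THE NEWTONIAN
KERNEL of `E`, normalised so that `Δ (Γ * g) = g` (Gilbarg–Trudinger (2.12) with the constant
written as an integral). [folklore] -/
def kernel (a : ℝ) (ξ : E) : ℝ := -(bumpMass E)⁻¹ * regKernel a ξ

/-- The approximate identity `ρ_a = A⁻¹ · regBump a = Δ Γ_a`. [folklore] -/
def approxId (a : ℝ) (ξ : E) : ℝ := (bumpMass E)⁻¹ * regBump a ξ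

omit [FiniteDimensional ℝ E] in
/-- The regularised kernels are measurable. [folklore] -/
@[fun_prop]
theorem measurable_regKernel (a : ℝ) : Measurable (regKernel a : E → ℝ) := by
  unfold regKernel; fun_prop

omit [FiniteDimensional ℝ E] in
/-- The bumps are measurable. [folklore] -/
@[fun_prop]
theorem measurable_regBump (a : ℝ) : Measurable (regBump a : E → ℝ) := by
  unfold regBump; fun_prop

/-- The kernels are measurable. [folklore] -/
@[fun_prop]
theorem measurable_kernel (a : ℝ) : Measurable (kernel a : E → ℝ) := by
  unfold kernel; fun_prop

/-- The approximate identities are measurable. [folklore] -/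
@[fun_prop]
theorem measurable_approxId (a : ℝ) : Measurable (approxId a : E → ℝ) := by
  unfold approxId; fun_prop

/-- The unit bump is integrable (`(1 + ‖ξ‖²)^{-(n+2)/2}` is, as `n + 2 > n`). [folklore] -/
theorem integrable_regBump_one : Integrable (regBump 1 : E → ℝ) := by
  have h : Integrable (fun ξ : E => (1 + ‖ξ‖ ^ 2) ^ (-((finrank ℝ E : ℝ) + 2) / 2)) :=
    integrable_rpow_neg_one_add_norm_sq (by linarith)
  have e : (regBump 1 : E → ℝ) = fun ξ =>
      ((finrank ℝ E : ℝ) * ((finrank ℝ E : ℝ) - 2) * 1) * (1 + ‖ξ‖ ^ 2) ^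
        (-((finrank ℝ E : ℝ) + 2) / 2) := by
    funext ξ
    simp only [regBump, expo]
    rw [add_comm (‖ξ‖ ^ 2) 1]
    congr 1
    ring_nf
  rw [e]
  exact h.const_mul _

/-- **The mass is positive** for `n ≥ 3`. [folklore] -/
theorem bumpMass_pos (hn : 3 ≤ finrank ℝ E) : 0 < bumpMass E := by
  haveI : Nontrivial E := Module.nontrivial_of_finrank_pos (R := ℝ) (by omega)
  unfold bumpMass
  rw [integral_pos_iff_support_of_nonneg (fun ξ => regBump_nonneg hn zero_le_one ξ)
    integrable_regBump_one]
  have hsupp : Function.support (regBump 1 : E → ℝ) = univ := by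
    ext ξ
    simp only [Function.mem_support, ne_eq, mem_univ, iff_true]
    exact (regBump_pos hn one_pos ξ).ne'
  rw [hsupp]
  simp

/-- The approximate identity is nonnegative (`a ≥ 0`, `n ≥ 3`). [folklore] -/
theorem approxId_nonneg (hn : 3 ≤ finrank ℝ E) {a : ℝ} (ha : 0 ≤ a) (ξ : E) : 0 ≤ approxId a ξ :=
  mul_nonneg (inv_nonneg.2 (bumpMass_pos hn).le) (regBump_nonneg hn ha ξ)

/-- `approxId 0 = 0`. [folklore] -/
@[simp] theorem approxId_zero (ξ : E) : approxId 0 ξ = 0 := by simp [approxId]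

/-- `Δ Γ_a = ρ_a` wherever the base is positive. [folklore] -/
theorem laplacian_kernel {a : ℝ} {ξ : E} (hξ : 0 < ‖ξ‖ ^ 2 + a) :
    (Δ (kernel a : E → ℝ)) ξ = approxId a ξ := by
  have e : (kernel a : E → ℝ) = fun w => -(bumpMass E)⁻¹ * regKernel a w := rfl
  rw [e, laplacian_const_mul, laplacian_regKernel hξ]
  simp [approxId]

/-- **The Newtonian kernel is harmonic off the origin**: `Δ Γ (ξ) = 0` for `ξ ≠ 0`. [folklore] -/
theorem laplacian_kernel_zero {ξ : E} (hξ : ξ ≠ 0) : (Δ (kernel 0 : E → ℝ)) ξ = 0 := by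
  rw [laplacian_kernel (base_pos_of_ne le_rfl hξ), approxId_zero]

/-- For `a > 0` the normalised kernel `Γ_a` is smooth on `E`. [folklore] -/
theorem contDiff_kernel {a : ℝ} (ha : 0 < a) {m : WithTop ℕ∞} : ContDiff ℝ m (kernel a : E → ℝ) :=
  contDiff_const.mul (contDiff_regKernel ha)

/-- For `a > 0` the approximate identity is smooth on `E`. [folklore] -/
theorem contDiff_approxId {a : ℝ} (ha : 0 < a) {m : WithTop ℕ∞} :
    ContDiff ℝ m (approxId a : E → ℝ) :=
  contDiff_const.mul (contDiff_regBump ha)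

/-- The kernels `Γ_a` (`a ≥ 0`) are smooth off the origin. [folklore] -/
theorem contDiffAt_kernel {a : ℝ} (ha : 0 ≤ a) {ξ : E} (hξ : ξ ≠ 0) {m : WithTop ℕ∞} :
    ContDiffAt ℝ m (kernel a : E → ℝ) ξ :=
  contDiffAt_const.mul (contDiffAt_regKernel ha hξ)

/-- `|Γ_a ξ| ≤ |Γ ξ|` for `a ≥ 0`, `ξ ≠ 0` (`n ≥ 2`). [folklore] -/
theorem abs_kernel_le_abs_kernel_zero (hn : 2 ≤ finrank ℝ E) {a : ℝ} (ha : 0 ≤ a) {ξ : E}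
    (hξ : ξ ≠ 0) : |kernel a ξ| ≤ |kernel 0 ξ| := by
  unfold kernel
  rw [abs_mul, abs_mul, abs_of_nonneg (regKernel_nonneg ha ξ),
    abs_of_nonneg (regKernel_nonneg le_rfl ξ)]
  exact mul_le_mul_of_nonneg_left (regKernel_le_regKernel_zero hn ha hξ) (abs_nonneg _)

/-- The value of `|Γ ξ|`: `A⁻¹ ‖ξ‖^{-(n-2)}` (`n ≥ 3`, all `ξ`; at `ξ = 0` both sides are the
junk `A⁻¹ · 0^{-(n-2)}`). [folklore] -/
theorem abs_kernel_zero_eq (hn : 3 ≤ finrank ℝ E) (ξ : E) :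
    |kernel 0 ξ| = (bumpMass E)⁻¹ * ‖ξ‖ ^ (-(2 * expo E)) := by
  unfold kernel regKernel
  rw [abs_mul, abs_neg, abs_of_pos (inv_pos.2 (bumpMass_pos hn)), add_zero,
    abs_of_nonneg (Real.rpow_nonneg (by positivity) _),
    show (‖ξ‖ ^ 2 : ℝ) = ‖ξ‖ ^ (2 : ℝ) by norm_cast, ← Real.rpow_mul (norm_nonneg _)]
  congr 2
  ring

/-- **The derivative bound for the kernels**: `‖D Γ_a (ξ)‖ ≤ (2k/A) ‖ξ‖^{-(n-1)}` for `a ≥ 0`,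
`ξ ≠ 0`, `n ≥ 3` (uniform in `a`). [folklore] -/
theorem norm_fderiv_kernel_le (hn : 3 ≤ finrank ℝ E) {a : ℝ} (ha : 0 ≤ a) {ξ : E} (hξ : ξ ≠ 0) :
    ‖fderiv ℝ (kernel a : E → ℝ) ξ‖ ≤
      2 * expo E * (bumpMass E)⁻¹ * ‖ξ‖ ^ (-(2 * expo E + 1)) := by
  have hb := base_pos_of_ne ha hξ
  have hA := bumpMass_pos hn
  have hk := expo_pos hn
  have e : (kernel a : E → ℝ) = fun w => -(bumpMass E)⁻¹ * regKernel a w := rfl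
  have hd : DifferentiableAt ℝ (regKernel a : E → ℝ) ξ := (hasFDerivAt_regKernel hb).differentiableAt
  rw [e, fderiv_const_mul hd, norm_smul, Real.norm_eq_abs, abs_neg, abs_of_pos (inv_pos.2 hA)]
  have h1 := norm_fderiv_regKernel_le (by omega) hb
  have h2 := base_rpow_mul_norm_le (by omega) ha hξ
  calc (bumpMass E)⁻¹ * ‖fderiv ℝ (regKernel a) ξ‖
      ≤ (bumpMass E)⁻¹ * (2 * expo E * (‖ξ‖ ^ 2 + a) ^ (-expo E - 1) * ‖ξ‖) :=
        mul_le_mul_of_nonneg_left h1 (inv_nonneg.2 hA.le)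
    _ = 2 * expo E * (bumpMass E)⁻¹ * ((‖ξ‖ ^ 2 + a) ^ (-expo E - 1) * ‖ξ‖) := by ring
    _ ≤ 2 * expo E * (bumpMass E)⁻¹ * ‖ξ‖ ^ (-(2 * expo E + 1)) :=
        mul_le_mul_of_nonneg_left h2 (by positivity)

/-- The kernels converge pointwise off the origin: `Γ_a ξ → Γ ξ` as `a → 0⁺`. [folklore] -/
theorem tendsto_kernel_nhdsWithin_zero {ξ : E} (hξ : ξ ≠ 0) :
    Tendsto (fun a : ℝ => kernel a ξ) (𝓝[≥] 0) (𝓝 (kernel 0 ξ)) := by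
  unfold kernel regKernel
  have hb : 0 < ‖ξ‖ ^ 2 + 0 := base_pos_of_ne le_rfl hξ
  have h1 : ContinuousAt (fun a : ℝ => (‖ξ‖ ^ 2 + a) ^ (-expo E)) 0 := by
    have : ContinuousAt (fun a : ℝ => ‖ξ‖ ^ 2 + a) 0 := by fun_prop
    exact this.rpow_const (Or.inl hb.ne')
  exact ((h1.tendsto.mono_left nhdsWithin_le_nhds).const_mul _)

/-- The derivatives of the kernels converge pointwise off the origin as `a → 0⁺`. [folklore] -/
theorem tendsto_fderiv_kernel_nhdsWithin_zero {ξ : E} (hξ : ξ ≠ 0) :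
    Tendsto (fun a : ℝ => fderiv ℝ (kernel a : E → ℝ) ξ) (𝓝[≥] 0)
      (𝓝 (fderiv ℝ (kernel 0 : E → ℝ) ξ)) := by
  -- explicit formula, valid for every `a ≥ 0`
  have hform : ∀ a : ℝ, 0 ≤ a → fderiv ℝ (kernel a : E → ℝ) ξ =
      (-(bumpMass E)⁻¹ * (2 * (-expo E * (‖ξ‖ ^ 2 + a) ^ (-expo E - 1)))) •
        (innerSL ℝ ξ : E →L[ℝ] ℝ) := by
    intro a ha
    have hb := base_pos_of_ne ha hξ
    have e : (kernel a : E → ℝ) = fun w => -(bumpMass E)⁻¹ * regKernel a w := rfl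
    rw [e, fderiv_const_mul (hasFDerivAt_regKernel hb).differentiableAt,
      (hasFDerivAt_regKernel hb).fderiv, smul_smul]
  have hb0 : 0 < ‖ξ‖ ^ 2 + 0 := base_pos_of_ne le_rfl hξ
  have hcoef : Tendsto (fun a : ℝ => -(bumpMass E)⁻¹ *
      (2 * (-expo E * (‖ξ‖ ^ 2 + a) ^ (-expo E - 1)))) (𝓝[≥] 0)
      (𝓝 (-(bumpMass E)⁻¹ * (2 * (-expo E * (‖ξ‖ ^ 2 + 0) ^ (-expo E - 1))))) := by
    have h1 : ContinuousAt (fun a : ℝ => (‖ξ‖ ^ 2 + a) ^ (-expo E - 1)) 0 := by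
      have : ContinuousAt (fun a : ℝ => ‖ξ‖ ^ 2 + a) 0 := by fun_prop
      exact this.rpow_const (Or.inl hb0.ne')
    have h2 : ContinuousAt (fun a : ℝ => -(bumpMass E)⁻¹ *
        (2 * (-expo E * (‖ξ‖ ^ 2 + a) ^ (-expo E - 1)))) 0 :=
      continuousAt_const.mul (continuousAt_const.mul (continuousAt_const.mul h1))
    exact h2.tendsto.mono_left nhdsWithin_le_nhds
  have key := hcoef.smul_const (innerSL ℝ ξ : E →L[ℝ] ℝ)
  rw [← hform 0 le_rfl] at key
  refine key.congr' ?_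
  filter_upwards [self_mem_nhdsWithin] with a ha using (hform a ha).symm

/-! ### The total mass of the approximate identity -/

/-- **The bumps all have mass `A`**: `∫ regBump (ε²) = bumpMass E` (`ε > 0`). [folklore] -/
theorem integral_regBump_sq {ε : ℝ} (hε : 0 < ε) : ∫ ξ : E, regBump (ε ^ 2) ξ = bumpMass E := by
  simp_rw [regBump_sq hε]
  rw [integral_const_mul, Measure.integral_comp_smul volume (regBump 1 : E → ℝ) ε⁻¹]
  unfold bumpMass
  rw [inv_pow, inv_inv, abs_of_pos (by positivity), smul_eq_mul, ← mul_assoc,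
    inv_mul_cancel₀ (by positivity), one_mul]

/-- `∫ ρ_{ε²} = 1` (`ε > 0`, `n ≥ 3`). [folklore] -/
theorem integral_approxId_sq (hn : 3 ≤ finrank ℝ E) {ε : ℝ} (hε : 0 < ε) :
    ∫ ξ : E, approxId (ε ^ 2) ξ = 1 := by
  unfold approxId
  rw [integral_const_mul, integral_regBump_sq hε, inv_mul_cancel₀ (bumpMass_pos hn).ne']

/-- The bumps `regBump (ε²)` are integrable (`ε > 0`). [folklore] -/
theorem integrable_regBump_sq {ε : ℝ} (hε : 0 < ε) : Integrable (regBump (ε ^ 2) : E → ℝ) := by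
  have e : (regBump (ε ^ 2) : E → ℝ) = fun ξ => (ε ^ finrank ℝ E)⁻¹ * regBump 1 (ε⁻¹ • ξ) :=
    funext (regBump_sq hε)
  rw [e]
  exact (integrable_regBump_one.comp_smul (inv_ne_zero hε.ne')).const_mul _

/-- The approximate identities `ρ_{ε²}` are integrable (`ε > 0`). [folklore] -/
theorem integrable_approxId_sq {ε : ℝ} (hε : 0 < ε) : Integrable (approxId (ε ^ 2) : E → ℝ) :=
  (integrable_regBump_sq hε).const_mul _

/-! ### Local integrability of `‖ξ‖^{-s}`, `s < n` -/

/-- **`∫_{B(0,r)} ‖ξ‖^{-s} dξ = n |B₁| r^{n-s}/(n-s)`** for `s < n` and `r > 0` (polar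
coordinates: Mathlib's `integral_fun_norm_addHaar`). [folklore] -/
theorem integral_ball_norm_rpow_neg (hn : 3 ≤ finrank ℝ E) {s : ℝ} (hs : s < finrank ℝ E)
    {r : ℝ} (hr : 0 < r) :
    ∫ ξ in ball (0 : E) r, ‖ξ‖ ^ (-s) =
      (finrank ℝ E : ℝ) * (volume : Measure E).real (ball 0 1) *
        (r ^ ((finrank ℝ E : ℝ) - s) / ((finrank ℝ E : ℝ) - s)) := by
  haveI : Nontrivial E := Module.nontrivial_of_finrank_pos (R := ℝ) (by omega)
  set q : ℝ := ((finrank ℝ E - 1 : ℕ) : ℝ) - s with hq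
  have hn1 : ((finrank ℝ E - 1 : ℕ) : ℝ) = (finrank ℝ E : ℝ) - 1 := by
    rw [Nat.cast_sub (by omega)]; simp
  have hq1 : q + 1 = (finrank ℝ E : ℝ) - s := by rw [hq, hn1]; ring
  have hqgt : -1 < q := by rw [hq, hn1]; linarith
  set f : ℝ → ℝ := (Iio r).indicator fun y => y ^ (-s) with hf
  have h1 : ∫ ξ in ball (0 : E) r, ‖ξ‖ ^ (-s) = ∫ ξ : E, f ‖ξ‖ := by
    rw [← integral_indicator measurableSet_ball]
    refine integral_congr_ae (Eventually.of_forall fun ξ => ?_)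
    simp only [hf, indicator, mem_ball_zero_iff, mem_Iio]
  rw [h1, integral_fun_norm_addHaar volume f, nsmul_eq_mul, smul_eq_mul, mul_assoc]
  congr 1
  congr 1
  -- the radial integral `∫_{y>0} y^{n-1} f(y) dy = ∫_0^r y^q dy = r^{q+1}/(q+1)`
  have h2 : ∫ y in Ioi (0 : ℝ), y ^ (finrank ℝ E - 1) • f y =
      ∫ y in Ioi (0 : ℝ), (Iio r).indicator (fun y : ℝ => y ^ q) y := by
    refine setIntegral_congr_fun measurableSet_Ioi fun y hy => ?_
    have hy' : 0 < y := hy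
    simp only [hf, indicator, mem_Iio, smul_eq_mul]
    split_ifs with h
    · rw [hq, ← Real.rpow_natCast, ← Real.rpow_add hy', sub_eq_add_neg]
    · rw [mul_zero]
  rw [h2, setIntegral_indicator measurableSet_Iio, Ioi_inter_Iio,
    ← integral_Ioc_eq_integral_Ioo, ← intervalIntegral.integral_of_le hr.le,
    integral_rpow (Or.inl hqgt), hq1, Real.zero_rpow (by linarith), sub_zero]

/-- `‖ξ‖^{-s}` is integrable on every ball about the origin, `s < n`. [folklore] -/
theorem integrableOn_ball_norm_rpow_neg (hn : 3 ≤ finrank ℝ E) {s : ℝ} (hs : s < finrank ℝ E)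
    (r : ℝ) : IntegrableOn (fun ξ : E => ‖ξ‖ ^ (-s)) (ball 0 r) := by
  haveI : Nontrivial E := Module.nontrivial_of_finrank_pos (R := ℝ) (by omega)
  rw [integrableOn_fun_norm_addHaar volume (f := fun y : ℝ => y ^ (-s))]
  set q : ℝ := ((finrank ℝ E - 1 : ℕ) : ℝ) - s with hq
  have hn1 : ((finrank ℝ E - 1 : ℕ) : ℝ) = (finrank ℝ E : ℝ) - 1 := by
    rw [Nat.cast_sub (by omega)]; simp
  have hqgt : -1 < q := by rw [hq, hn1]; linarith
  have hI : IntegrableOn (fun y : ℝ => y ^ q) (Ioo 0 r) := by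
    have := (intervalIntegral.intervalIntegrable_rpow' hqgt (a := 0) (b := r)).1
    exact this.mono_set Ioo_subset_Ioc_self
  refine hI.congr_fun (fun y hy => ?_) measurableSet_Ioo
  have hy' : 0 < y := hy.1
  simp only [smul_eq_mul]
  rw [hq, ← Real.rpow_natCast, ← Real.rpow_add hy', sub_eq_add_neg]

/-- `‖ξ‖^{-s}` is integrable on every bounded measurable set, `s < n`. [folklore] -/
theorem integrableOn_norm_rpow_neg_of_isBounded (hn : 3 ≤ finrank ℝ E) {s : ℝ}
    (hs : s < finrank ℝ E) {S : Set E} (hS : Bornology.IsBounded S) :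
    IntegrableOn (fun ξ : E => ‖ξ‖ ^ (-s)) S := by
  obtain ⟨r, hr⟩ := hS.subset_ball 0
  exact (integrableOn_ball_norm_rpow_neg hn hs r).mono_set hr

/-- Translated form: `z ↦ ‖x - z‖^{-s}` is integrable on `B(x, r)`, with the same integral as
`‖ξ‖^{-s}` on `B(0, r)` (the reflection-translation `z ↦ x - z` preserves Haar measure).
[folklore] -/
theorem integrableOn_ball_norm_sub_rpow_neg (hn : 3 ≤ finrank ℝ E) {s : ℝ}
    (hs : s < finrank ℝ E) (x : E) (r : ℝ) :
    IntegrableOn (fun z : E => ‖x - z‖ ^ (-s)) (ball x r) ∧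
      ∫ z in ball x r, ‖x - z‖ ^ (-s) = ∫ ξ in ball (0 : E) r, ‖ξ‖ ^ (-s) := by
  have hT : MeasurePreserving (fun z : E => x - z) volume volume := Measure.measurePreserving_sub_left volume x
  have he : MeasurableEmbedding (fun z : E => x - z) := (Homeomorph.subLeft x).measurableEmbedding
  have hpre : (fun z : E => x - z) ⁻¹' (ball 0 r) = ball x r := by
    ext z; simp [mem_ball, dist_eq_norm, norm_sub_rev]
  constructor
  · have := (hT.integrableOn_comp_preimage he (f := fun ξ : E => ‖ξ‖ ^ (-s))
      (s := ball 0 r)).2 (integrableOn_ball_norm_rpow_neg hn hs r)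
    rwa [hpre] at this
  · have := hT.setIntegral_preimage_emb he (fun ξ : E => ‖ξ‖ ^ (-s)) (ball 0 r)
    rw [hpre] at this
    exact this

/-- `z ↦ ‖x - z‖^{-s}` is integrable on every ball `B(c, R)` (any centre), `s < n`. [folklore] -/
theorem integrableOn_norm_sub_rpow_neg (hn : 3 ≤ finrank ℝ E) {s : ℝ} (hs : s < finrank ℝ E)
    (x c : E) (R : ℝ) : IntegrableOn (fun z : E => ‖x - z‖ ^ (-s)) (ball c R) := by
  refine (integrableOn_ball_norm_sub_rpow_neg hn hs x (R + dist c x)).1.mono_set ?_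
  intro z hz
  rw [mem_ball] at hz ⊢
  calc dist z x ≤ dist z c + dist c x := dist_triangle _ _ _
    _ < R + dist c x := by linarith

/-- The real volume of a ball: `|B(c,R)| = Rⁿ |B₁|` (`R ≥ 0`). [folklore] -/
theorem volume_real_ball (hn : 3 ≤ finrank ℝ E) (c : E) {R : ℝ} (hR : 0 ≤ R) :
    (volume : Measure E).real (ball c R) = R ^ finrank ℝ E * (volume : Measure E).real (ball 0 1) := by
  haveI : Nontrivial E := Module.nontrivial_of_finrank_pos (R := ℝ) (by omega)
  rw [measureReal_def, Measure.addHaar_ball volume c hR, ENNReal.toReal_mul,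
    ENNReal.toReal_ofReal (by positivity), measureReal_def]

/-- **The basic potential bound**: for `0 ≤ s < n`, `R > 0` and ANY centre `c` and point `x`,
`∫_{B(c,R)} ‖x - z‖^{-s} dz ≤ (n/(n-s) + 1) |B₁| R^{n-s}` (split `B(c,R)` into the part inside
`B(x,R)`, where the polar formula applies, and the rest, where `‖x - z‖ ≥ R`). [folklore] -/
theorem setIntegral_ball_norm_sub_rpow_neg_le (hn : 3 ≤ finrank ℝ E) {s : ℝ} (hs0 : 0 ≤ s)
    (hs : s < finrank ℝ E) (c x : E) {R : ℝ} (hR : 0 < R) :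
    ∫ z in ball c R, ‖x - z‖ ^ (-s) ≤
      ((finrank ℝ E : ℝ) / ((finrank ℝ E : ℝ) - s) + 1) * (volume : Measure E).real (ball 0 1) *
        R ^ ((finrank ℝ E : ℝ) - s) := by
  haveI : Nontrivial E := Module.nontrivial_of_finrank_pos (R := ℝ) (by omega)
  set n : ℝ := (finrank ℝ E : ℝ) with hn'
  set B : ℝ := (volume : Measure E).real (ball 0 1) with hB
  have hB0 : 0 ≤ B := measureReal_nonneg
  have hns : 0 < n - s := by linarith
  set f : E → ℝ := fun z => ‖x - z‖ ^ (-s) with hf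
  have hf0 : ∀ z, 0 ≤ f z := fun z => Real.rpow_nonneg (norm_nonneg _) _
  have hint : IntegrableOn f (ball c R) := integrableOn_norm_sub_rpow_neg hn hs x c R
  -- split `ball c R` along `ball x R`
  rw [← integral_inter_add_sdiff (μ := volume) measurableSet_ball hint]
  -- the near part
  have hnear : ∫ z in ball c R ∩ ball x R, f z ≤ n * B * (R ^ (n - s) / (n - s)) := by
    obtain ⟨hix, heq⟩ := integrableOn_ball_norm_sub_rpow_neg hn hs x R
    calc ∫ z in ball c R ∩ ball x R, f z ≤ ∫ z in ball x R, f z :=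
          setIntegral_mono_set hix (Eventually.of_forall hf0)
            (Eventually.of_forall inter_subset_right)
      _ = n * B * (R ^ (n - s) / (n - s)) := by
          rw [hf]
          rw [heq, integral_ball_norm_rpow_neg hn hs hR]
  -- the far part: `f ≤ R^{-s}` there, and the volume is at most `Rⁿ |B₁|`
  have hfar : ∫ z in ball c R \ ball x R, f z ≤ B * R ^ (n - s) := by
    have hS : MeasurableSet (ball c R \ ball x R) := measurableSet_ball.diff measurableSet_ball
    have hvol : (volume : Measure E).real (ball c R \ ball x R) ≤ R ^ finrank ℝ E * B := by
      calc (volume : Measure E).real (ball c R \ ball x R) ≤ (volume : Measure E).real (ball c R) :=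
            measureReal_mono sdiff_subset measure_ball_lt_top.ne
        _ = R ^ finrank ℝ E * B := volume_real_ball hn c hR.le
    have hfin : volume (ball c R \ ball x R) < ⊤ :=
      (measure_mono sdiff_subset).trans_lt measure_ball_lt_top
    have hbd : ∀ z ∈ ball c R \ ball x R, f z ≤ R ^ (-s) := by
      intro z hz
      have hz' : R ≤ ‖x - z‖ := by
        have := hz.2
        rw [mem_ball, dist_eq_norm, not_lt, norm_sub_rev] at this
        exact this
      exact Real.rpow_le_rpow_of_nonpos hR hz' (by linarith)
    calc ∫ z in ball c R \ ball x R, f z ≤ ∫ z in ball c R \ ball x R, R ^ (-s) := by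
          refine setIntegral_mono_on (hint.mono_set sdiff_subset) ?_ hS hbd
          exact integrableOn_const hfin.ne
      _ = (volume : Measure E).real (ball c R \ ball x R) * R ^ (-s) := by
          rw [setIntegral_const, smul_eq_mul]
      _ ≤ R ^ finrank ℝ E * B * R ^ (-s) :=
          mul_le_mul_of_nonneg_right hvol (Real.rpow_nonneg hR.le _)
      _ = B * R ^ (n - s) := by
          rw [hn', show (n - s : ℝ) = (finrank ℝ E : ℕ) + (-s) by rw [hn']; ring,
            Real.rpow_add hR, Real.rpow_natCast]
          ring
  calc (∫ z in ball c R ∩ ball x R, f z) + ∫ z in ball c R \ ball x R, f z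
      ≤ n * B * (R ^ (n - s) / (n - s)) + B * R ^ (n - s) := add_le_add hnear hfar
    _ = (n / (n - s) + 1) * B * R ^ (n - s) := by
        field_simp

end Measure

end Newtonian

end Literature.Analysis.PDE
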